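import Literature.NumberTheory.Sieve.BombieriVinogradovMoebius
import HarnessLib

/-!
# Möbius sums in residue classes: partial summation against `log`, non-reduced classes, and the per-modulus bound

Topic `Literature/NumberTheory/Sieve`; everything in this file is PROVED and elementary.  It
prepares sums `∑_{b ≡ c (L)} μ(b) log b` over possibly NON-reduced residue classes for the
Bombieri–Vinogradov theorem for `μ` (`Literature.NumberTheory.Sieve.bombieriVinogradov_moebius`,
whose terms `BVMoebius.moebiusAPSum N q a = ∑_{n ≤ N, n ≡ a (q)} μ(n)` want reduced `a`):

* `abs_sum_Ioc_mul_log_le`, `exists_abs_sum_Ioc_mul_log_le` — partial summation removing a weight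
  `log b` on an interval `(N', N]` at the cost of `2 log N` and the largest partial sum;
* `exists_abs_sum_moebius_congr_le` — if `g = gcd(r, L)` is a unitary divisor of `L`
  (`gcd(g, L/g) = 1`), then `|∑_{b ≤ t, b ≡ r (L)} μ(b)| ≤ g · |∑_{b' ≤ t/g, b' ≡ c (L)} μ(b')|` for
  some REDUCED class `c`: `b = g b'`, `μ(g b') = μ(g) μ(b') 𝟙[(b', g) = 1]`, and the admissible `b'`
  fill at most `g` classes modulo `L`, all reduced;
* `exists_sum_abs_sum_moebius_log_congr_le` — the per-modulus bound: for at most `s` classes, each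
  with `gcd(c, L) ≤ s` unitary,
  `∑_c |∑_{N' < b ≤ N, b ≡ c (L)} μ(b) log b| ≤ 2 s² log N · |∑_{b ≤ t, b ≡ a (L)} μ(b)|`
  for one cut-off `t ≤ N` and one reduced class `a` — one term of the Bombieri–Vinogradov sum.

## References

* H. Iwaniec, E. Kowalski, *Analytic Number Theory*, AMS Colloquium Publ. 53 (2004), §17.3.
  [IwaniecKowalski2004]
-/

namespace Literature.NumberTheory.Sieve

namespace BVMoebius

open Finset Real ArithmeticFunction
open scoped ArithmeticFunction.Moebius

/-! ### Partial summation against `log` -/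

/-- `∑_{1 ≤ i ≤ t} c(i) = ∑_{i < t} c(i+1)`. [folklore] -/
theorem sum_Icc_one_eq_sum_range (c : ℕ → ℝ) (t : ℕ) :
    ∑ i ∈ Icc 1 t, c i = ∑ i ∈ range t, c (i + 1) := by
  induction t with
  | zero => simp
  | succ t ih => rw [Finset.sum_Icc_succ_top (by omega), ih, Finset.sum_range_succ]

/-- Telescoping over `Ioc a b`. [folklore] -/
theorem sum_Ioc_sub_telescope (f : ℕ → ℝ) {a b : ℕ} (h : a ≤ b) :
    ∑ i ∈ Ioc a b, (f (i + 1) - f i) = f (b + 1) - f (a + 1) := by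
  induction b, h using Nat.le_induction with
  | base => simp
  | succ b hab ih => rw [Finset.sum_Ioc_succ_top hab, ih]; ring

/-- **Partial summation against `log`**: if `|∑_{1 ≤ b ≤ t} c(b)| ≤ M` for all `N' ≤ t ≤ N`
(`M ≥ 0`), then `|∑_{N' < b ≤ N} c(b) log b| ≤ 2 M log N`. [folklore] -/
theorem abs_sum_Ioc_mul_log_le {c : ℕ → ℝ} {N' N : ℕ} {M : ℝ} (hM0 : 0 ≤ M)
    (hM : ∀ t, N' ≤ t → t ≤ N → |∑ b ∈ Icc 1 t, c b| ≤ M) :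
    |∑ b ∈ Ioc N' N, c b * Real.log b| ≤ 2 * M * Real.log N := by
  have hlogN : 0 ≤ Real.log (N : ℝ) := Real.log_natCast_nonneg N
  rcases lt_or_ge N' N with hlt | hge
  swap
  · rw [Finset.Ioc_eq_empty (by omega), sum_empty, abs_zero]; positivity
  set g : ℕ → ℝ := fun i => if i = 0 then 0 else c i with hg
  have hG : ∀ t, ∑ i ∈ range (t + 1), g i = ∑ i ∈ Icc 1 t, c i := by
    intro t
    rw [Finset.sum_range_succ', sum_Icc_one_eq_sum_range]
    simp [hg]
  have hfg : ∑ b ∈ Ioc N' N, c b * Real.log b = ∑ i ∈ Ioc N' N, (Real.log i) • g i := by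
    refine sum_congr rfl fun i hi => ?_
    have hi0 : i ≠ 0 := by have := (mem_Ioc.1 hi).1; omega
    simp [hg, hi0, mul_comm]
  rw [hfg, Finset.sum_Ioc_by_parts (fun i : ℕ => Real.log i) g hlt]
  simp only [smul_eq_mul, hG]
  have hA : |Real.log (N : ℝ) * ∑ i ∈ Icc 1 N, c i| ≤ M * Real.log N := by
    rw [abs_mul, abs_of_nonneg hlogN, mul_comm]
    exact mul_le_mul_of_nonneg_right (hM N hlt.le le_rfl) hlogN
  have hlogN'1 : 0 ≤ Real.log ((N' + 1 : ℕ) : ℝ) := Real.log_natCast_nonneg _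
  have hlogN'N : Real.log ((N' + 1 : ℕ) : ℝ) ≤ Real.log N :=
    Real.log_le_log (by positivity) (by exact_mod_cast hlt)
  have hB : |Real.log ((N' + 1 : ℕ) : ℝ) * ∑ i ∈ Icc 1 N', c i| ≤
      M * Real.log ((N' + 1 : ℕ) : ℝ) := by
    rw [abs_mul, abs_of_nonneg hlogN'1, mul_comm]
    exact mul_le_mul_of_nonneg_right (hM N' le_rfl hlt.le) hlogN'1
  have hC : |∑ i ∈ Ioc N' (N - 1), (Real.log ((i + 1 : ℕ) : ℝ) - Real.log i) *
      ∑ j ∈ Icc 1 i, c j| ≤ M * (Real.log N - Real.log ((N' + 1 : ℕ) : ℝ)) := by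
    refine (abs_sum_le_sum_abs _ _).trans ?_
    have hstep : ∀ i ∈ Ioc N' (N - 1), |(Real.log ((i + 1 : ℕ) : ℝ) - Real.log i) *
        ∑ j ∈ Icc 1 i, c j| ≤ M * (Real.log ((i + 1 : ℕ) : ℝ) - Real.log i) := by
      intro i hi
      have hi1 : 1 ≤ i := by have := (mem_Ioc.1 hi).1; omega
      have hdiff : 0 ≤ Real.log ((i + 1 : ℕ) : ℝ) - Real.log i := by
        have : Real.log (i : ℝ) ≤ Real.log ((i + 1 : ℕ) : ℝ) :=
          Real.log_le_log (by exact_mod_cast hi1) (by push_cast; linarith)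
        linarith
      rw [abs_mul, abs_of_nonneg hdiff, mul_comm]
      refine mul_le_mul_of_nonneg_right (hM i (mem_Ioc.1 hi).1.le ?_) hdiff
      have := (mem_Ioc.1 hi).2; omega
    refine (sum_le_sum hstep).trans ?_
    rw [← mul_sum, sum_Ioc_sub_telescope (fun i : ℕ => Real.log (i : ℝ)) (by omega : N' ≤ N - 1)]
    have hN : N - 1 + 1 = N := by omega
    rw [hN]
  calc |Real.log (N : ℝ) * ∑ i ∈ Icc 1 N, c i - Real.log ((N' + 1 : ℕ) : ℝ) * ∑ i ∈ Icc 1 N', c i -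
        ∑ i ∈ Ioc N' (N - 1), (Real.log ((i + 1 : ℕ) : ℝ) - Real.log i) * ∑ j ∈ Icc 1 i, c j|
      ≤ |Real.log (N : ℝ) * ∑ i ∈ Icc 1 N, c i| + |Real.log ((N' + 1 : ℕ) : ℝ) * ∑ i ∈ Icc 1 N', c i| +
        |∑ i ∈ Ioc N' (N - 1), (Real.log ((i + 1 : ℕ) : ℝ) - Real.log i) * ∑ j ∈ Icc 1 i, c j| :=
        (abs_sub _ _).trans (add_le_add (abs_sub _ _) le_rfl)
    _ ≤ M * Real.log N + M * Real.log ((N' + 1 : ℕ) : ℝ) +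
        M * (Real.log N - Real.log ((N' + 1 : ℕ) : ℝ)) := add_le_add (add_le_add hA hB) hC
    _ = 2 * M * Real.log N := by ring

/-- Partial summation against `log`, with the maximal partial sum exhibited: there is `t ≤ N` with
`|∑_{N' < b ≤ N} c(b) log b| ≤ 2 log N · |∑_{1 ≤ b ≤ t} c(b)|`. [folklore] -/
theorem exists_abs_sum_Ioc_mul_log_le (c : ℕ → ℝ) (N' N : ℕ) :
    ∃ t, t ≤ N ∧ |∑ b ∈ Ioc N' N, c b * Real.log b| ≤
      2 * Real.log N * |∑ b ∈ Icc 1 t, c b| := by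
  have hlogN : 0 ≤ Real.log (N : ℝ) := Real.log_natCast_nonneg N
  rcases lt_or_ge N N' with hlt | hge
  · refine ⟨0, Nat.zero_le _, ?_⟩
    rw [Finset.Ioc_eq_empty (by omega), sum_empty, abs_zero]; positivity
  obtain ⟨t, ht, hmax⟩ := Finset.exists_max_image (Icc N' N)
    (fun t => |∑ b ∈ Icc 1 t, c b|) ⟨N, mem_Icc.2 ⟨hge, le_rfl⟩⟩
  refine ⟨t, (mem_Icc.1 ht).2, ?_⟩
  have h := abs_sum_Ioc_mul_log_le (c := c) (abs_nonneg _)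
    (fun u hu1 hu2 => hmax u (mem_Icc.2 ⟨hu1, hu2⟩))
  linarith
/-! ### Non-reduced residue classes -/

/-- **Non-reduced classes.** Let `g = gcd(r, L)` be a unitary divisor of `L ≥ 1`
(`gcd(g, L/g) = 1`).  Then for some reduced class `c (mod L)`,
`|∑_{b ≤ t, b ≡ r (L)} μ(b)| ≤ g · |∑_{b' ≤ t/g, b' ≡ c (L)} μ(b')|`: writing `b = g b'`,
`μ(g b') = μ(g) μ(b') 𝟙[(b', g) = 1]`, and the `b'` with `b' ≡ r/g (L/g)`, `(b', g) = 1` fill at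
most `g` classes modulo `L`, all reduced. [folklore] -/
theorem exists_abs_sum_moebius_congr_le {L : ℕ} (hL : 0 < L) (r t : ℕ)
    (hunit : (Nat.gcd r L).Coprime (L / Nat.gcd r L)) :
    ∃ c : ℕ, c.Coprime L ∧
      |∑ b ∈ (Icc 1 t).filter (fun b : ℕ => b ≡ r [MOD L]), (μ b : ℝ)| ≤
        (Nat.gcd r L) * |moebiusAPSum (t / Nat.gcd r L) L (c : ZMod L)| := by
  set g := Nat.gcd r L with hgdef
  have hg0 : 0 < g := Nat.gcd_pos_of_pos_right r hL
  obtain ⟨L', hL'⟩ : g ∣ L := Nat.gcd_dvd_right r L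
  obtain ⟨r', hr'⟩ : g ∣ r := Nat.gcd_dvd_left r L
  have hLg : L / g = L' := by rw [hL', Nat.mul_div_cancel_left L' hg0]
  have hrg : r / g = r' := by rw [hr', Nat.mul_div_cancel_left r' hg0]
  have hL'0 : 0 < L' := by
    rcases Nat.eq_zero_or_pos L' with h | h
    · rw [h, mul_zero] at hL'; omega
    · exact h
  have hgL' : g.Coprime L' := by rwa [hLg] at hunit
  have hr'L' : r'.Coprime L' := by
    have h2 := Nat.coprime_div_gcd_div_gcd (m := r) (n := L) hg0
    rwa [← hgdef, hrg, hLg] at h2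
  -- Step 1: `b = g b'`
  set S := (Icc 1 t).filter (fun b : ℕ => b ≡ r [MOD L]) with hSdef
  set S' := (Icc 1 (t / g)).filter (fun b' : ℕ => b' ≡ r' [MOD L']) with hS'def
  have hS : S = S'.image (fun b' => g * b') := by
    ext b
    simp only [hSdef, hS'def, mem_filter, mem_Icc, mem_image]
    constructor
    · rintro ⟨⟨hb1, hbt⟩, hbr⟩
      have hgb : g ∣ b := by
        have h1 : b ≡ r [MOD g] := hbr.of_dvd ⟨L', hL'⟩
        have h2 : r ≡ 0 [MOD g] := Nat.modEq_zero_iff_dvd.2 ⟨r', hr'⟩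
        exact Nat.modEq_zero_iff_dvd.1 (h1.trans h2)
      obtain ⟨b', rfl⟩ := hgb
      refine ⟨b', ⟨⟨?_, ?_⟩, ?_⟩, rfl⟩
      · rcases Nat.eq_zero_or_pos b' with h | h
        · rw [h, mul_zero] at hb1; omega
        · exact h
      · rw [Nat.le_div_iff_mul_le hg0, mul_comm]; exact hbt
      · rw [hr', hL'] at hbr
        exact Nat.ModEq.mul_left_cancel' hg0.ne' hbr
    · rintro ⟨b', ⟨⟨hb1, hbt⟩, hbr⟩, rfl⟩
      refine ⟨⟨Nat.mul_pos hg0 hb1, ?_⟩, ?_⟩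
      · have := (Nat.le_div_iff_mul_le hg0).1 hbt; rw [mul_comm]; exact this
      · rw [hr', hL']; exact Nat.ModEq.mul_left' g hbr
  have hsum1 : ∑ b ∈ S, (μ b : ℝ) = ∑ b' ∈ S', (μ (g * b') : ℝ) := by
    rw [hS, sum_image]
    intro x _ y _ h
    exact Nat.eq_of_mul_eq_mul_left hg0 h
  -- Step 2: `μ(g b') = μ(g) μ(b') 𝟙[(b', g) = 1]`
  have hmul : ∀ b' : ℕ, (μ (g * b') : ℝ) = if b'.Coprime g then (μ g : ℝ) * μ b' else 0 := by
    intro b'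
    split_ifs with h
    · rw [ArithmeticFunction.isMultiplicative_moebius.map_mul_of_coprime h.symm]; push_cast; rfl
    · have : ¬ Squarefree (g * b') := fun hsq => h (Nat.squarefree_mul_iff.1 hsq).1.symm
      rw [ArithmeticFunction.moebius_eq_zero_of_not_squarefree this]; simp
  have hsum2 : ∑ b' ∈ S', (μ (g * b') : ℝ) =
      (μ g : ℝ) * ∑ b' ∈ S'.filter (fun b' => b'.Coprime g), (μ b' : ℝ) := by
    conv_rhs => rw [sum_filter, mul_sum]
    refine sum_congr rfl fun b' _ => ?_
    rw [hmul]
    split_ifs <;> simp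
  -- Step 3: partition by the class modulo `L`
  set P : ℕ → Prop := fun c => c ≡ r' [MOD L'] ∧ c.Coprime g with hPdef
  set 𝒞 := (range L).filter P with h𝒞def
  have hsum3 : ∑ b' ∈ S'.filter (fun b' => b'.Coprime g), (μ b' : ℝ) =
      ∑ c ∈ 𝒞, moebiusAPSum (t / g) L (c : ZMod L) := by
    have hfib := (sum_fiberwise_of_maps_to (s := S'.filter (fun b' => b'.Coprime g))
      (g := fun b' => b' % L) (t := range L) (fun b' _ => mem_range.2 (Nat.mod_lt _ hL))
      (fun b' => (μ b' : ℝ))).symm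
    have h2 : ∑ c ∈ 𝒞, moebiusAPSum (t / g) L (c : ZMod L) =
        ∑ c ∈ range L, if P c then moebiusAPSum (t / g) L (c : ZMod L) else 0 := by
      rw [h𝒞def, sum_filter]
    rw [hfib, h2]
    refine sum_congr rfl fun c hc => ?_
    have hcL : c < L := mem_range.1 hc
    have hgL : g ∣ L := ⟨L', hL'⟩
    have hL'L : L' ∣ L := ⟨g, by rw [hL', mul_comm]⟩
    by_cases hPc : P c
    · rw [if_pos hPc, moebiusAPSum]
      refine sum_congr ?_ fun _ _ => rfl
      ext b'
      simp only [hS'def, mem_filter, mem_Icc]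
      constructor
      · rintro ⟨⟨⟨hb, _⟩, _⟩, hbc⟩
        refine ⟨hb, ?_⟩
        rw [ZMod.natCast_eq_natCast_iff', Nat.mod_eq_of_lt hcL]
        exact hbc
      · rintro ⟨hb, hbc⟩
        rw [ZMod.natCast_eq_natCast_iff', Nat.mod_eq_of_lt hcL] at hbc
        have hmod : b' ≡ c [MOD L] := by rw [Nat.ModEq, Nat.mod_eq_of_lt hcL]; exact hbc
        refine ⟨⟨⟨hb, (hmod.of_dvd hL'L).trans hPc.1⟩, ?_⟩, hbc⟩
        have := (hmod.of_dvd hgL).gcd_eq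
        rw [Nat.Coprime, this]; exact hPc.2
    · rw [if_neg hPc]
      refine sum_eq_zero fun b' hb' => ?_
      exfalso
      apply hPc
      simp only [hS'def, mem_filter, mem_Icc] at hb'
      obtain ⟨⟨⟨_, hbr⟩, hcop⟩, hbc⟩ := hb'
      have hmod : b' ≡ c [MOD L] := by rw [Nat.ModEq, Nat.mod_eq_of_lt hcL]; exact hbc
      refine ⟨(hmod.of_dvd hL'L).symm.trans hbr, ?_⟩
      have := (hmod.of_dvd hgL).gcd_eq
      rw [Nat.Coprime, ← this]; exact hcop
  -- Step 4: at most `g` classes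
  have hcard : #𝒞 ≤ g := by
    calc #𝒞 ≤ #((range L).filter (fun c => c ≡ r' [MOD L'])) := by
          refine card_le_card fun c hc => ?_
          rw [h𝒞def, mem_filter] at hc
          exact mem_filter.2 ⟨hc.1, hc.2.1⟩
      _ ≤ #(range g) := by
          refine card_le_card_of_injOn (fun c => c / L') (fun c hc => ?_) ?_
          · rw [Finset.mem_coe, mem_filter, mem_range] at hc
            rw [Finset.mem_coe, mem_range, Nat.div_lt_iff_lt_mul hL'0, ← hL']
            exact hc.1
          · intro c₁ hc₁ c₂ hc₂ h
            rw [Finset.mem_coe, mem_filter] at hc₁ hc₂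
            have hmod : c₁ % L' = c₂ % L' := hc₁.2.trans hc₂.2.symm
            calc c₁ = L' * (c₁ / L') + c₁ % L' := (Nat.div_add_mod c₁ L').symm
              _ = L' * (c₂ / L') + c₂ % L' := by rw [show c₁ / L' = c₂ / L' from h, hmod]
              _ = c₂ := Nat.div_add_mod c₂ L'
      _ = g := card_range g
  -- Step 5: conclusion
  rw [hsum1, hsum2, hsum3]
  by_cases h𝒞 : 𝒞.Nonempty
  · obtain ⟨c, hc, hmax⟩ :=
      exists_max_image 𝒞 (fun c => |moebiusAPSum (t / g) L (c : ZMod L)|) h𝒞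
    have hPc : P c := (mem_filter.1 hc).2
    refine ⟨c, ?_, ?_⟩
    · have h1 : c.Coprime L' := by
        have := hPc.1.gcd_eq
        rw [Nat.Coprime, this]; exact hr'L'
      rw [hL']; exact Nat.Coprime.mul_right hPc.2 h1
    · rw [abs_mul]
      calc |(μ g : ℝ)| * |∑ c' ∈ 𝒞, moebiusAPSum (t / g) L (c' : ZMod L)|
          ≤ 1 * ∑ c' ∈ 𝒞, |moebiusAPSum (t / g) L (c' : ZMod L)| :=
            mul_le_mul (by exact_mod_cast abs_moebius_le_one) (abs_sum_le_sum_abs _ _)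
              (abs_nonneg _) zero_le_one
        _ ≤ ∑ _c' ∈ 𝒞, |moebiusAPSum (t / g) L (c : ZMod L)| := by
            rw [one_mul]; exact sum_le_sum hmax
        _ = #𝒞 * |moebiusAPSum (t / g) L (c : ZMod L)| := by rw [sum_const, nsmul_eq_mul]
        _ ≤ g * |moebiusAPSum (t / g) L (c : ZMod L)| :=
            mul_le_mul_of_nonneg_right (by exact_mod_cast hcard) (abs_nonneg _)
  · refine ⟨1, Nat.coprime_one_left L, ?_⟩
    rw [Finset.not_nonempty_iff_eq_empty.1 h𝒞, sum_empty, mul_zero, abs_zero]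
    positivity

/-! ### The per-modulus bound -/

/-- **Per modulus.** Let `𝒞` be at most `s` residues, each with `gcd(c, L) ≤ s` a unitary divisor
of `L ≥ 1`.  Then for some cut-off `t ≤ N` and some reduced class `a (mod L)`,
`∑_{c ∈ 𝒞} |∑_{N' < b ≤ N, b ≡ c (L)} μ(b) log b| ≤ 2 s² log N · |∑_{b ≤ t, b ≡ a (L)} μ(b)|`
(partial summation, `exists_abs_sum_moebius_congr_le`, and the largest of the `≤ s` terms).
[folklore] -/
theorem exists_sum_abs_sum_moebius_log_congr_le {L : ℕ} (hL : 0 < L) {s : ℕ} (𝒞 : Finset ℕ)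
    (hcard : #𝒞 ≤ s) (hgcd : ∀ c ∈ 𝒞, Nat.gcd c L ≤ s)
    (hunit : ∀ c ∈ 𝒞, (Nat.gcd c L).Coprime (L / Nat.gcd c L)) (N' N : ℕ) :
    ∃ t, t ≤ N ∧ ∃ a : ℕ, a.Coprime L ∧
      ∑ c ∈ 𝒞, |∑ b ∈ (Ioc N' N).filter (fun b : ℕ => b ≡ c [MOD L]), (μ b : ℝ) * Real.log b| ≤
        2 * (s : ℝ) ^ 2 * Real.log N * |moebiusAPSum t L (a : ZMod L)| := by
  have hlogN : 0 ≤ Real.log (N : ℝ) := Real.log_natCast_nonneg N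
  -- one class at a time
  have hper : ∀ c ∈ 𝒞, ∃ t, t ≤ N ∧ ∃ a : ℕ, a.Coprime L ∧
      |∑ b ∈ (Ioc N' N).filter (fun b : ℕ => b ≡ c [MOD L]), (μ b : ℝ) * Real.log b| ≤
        2 * (s : ℝ) * Real.log N * |moebiusAPSum t L (a : ZMod L)| := by
    intro c hc
    set w : ℕ → ℝ := fun b => if b ≡ c [MOD L] then (μ b : ℝ) else 0 with hwdef
    have hw : ∑ b ∈ (Ioc N' N).filter (fun b : ℕ => b ≡ c [MOD L]), (μ b : ℝ) * Real.log b =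
        ∑ b ∈ Ioc N' N, w b * Real.log b := by
      rw [sum_filter]
      refine sum_congr rfl fun b _ => ?_
      simp only [hwdef]
      split_ifs <;> simp
    have hw' : ∀ t, ∑ b ∈ Icc 1 t, w b =
        ∑ b ∈ (Icc 1 t).filter (fun b : ℕ => b ≡ c [MOD L]), (μ b : ℝ) := by
      intro t; rw [sum_filter]
    obtain ⟨t, htN, ht⟩ := exists_abs_sum_Ioc_mul_log_le w N' N
    obtain ⟨a, ha, hred⟩ := exists_abs_sum_moebius_congr_le hL c t (hunit c hc)
    refine ⟨t / Nat.gcd c L, (Nat.div_le_self _ _).trans htN, a, ha, ?_⟩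
    rw [hw]
    refine ht.trans ?_
    rw [hw']
    have h2 : (0 : ℝ) ≤ 2 * Real.log N := by positivity
    calc 2 * Real.log N * |∑ b ∈ (Icc 1 t).filter (fun b : ℕ => b ≡ c [MOD L]), (μ b : ℝ)|
        ≤ 2 * Real.log N * ((Nat.gcd c L : ℝ) * |moebiusAPSum (t / Nat.gcd c L) L (a : ZMod L)|) :=
          mul_le_mul_of_nonneg_left hred h2
      _ ≤ 2 * Real.log N * ((s : ℝ) * |moebiusAPSum (t / Nat.gcd c L) L (a : ZMod L)|) := by
          refine mul_le_mul_of_nonneg_left (mul_le_mul_of_nonneg_right ?_ (abs_nonneg _)) h2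
          exact_mod_cast hgcd c hc
      _ = 2 * (s : ℝ) * Real.log N * |moebiusAPSum (t / Nat.gcd c L) L (a : ZMod L)| := by ring
  choose! t ht a ha hb using hper
  by_cases h𝒞 : 𝒞.Nonempty
  · obtain ⟨c, hc, hmax⟩ :=
      exists_max_image 𝒞 (fun c => |moebiusAPSum (t c) L (a c : ZMod L)|) h𝒞
    have hK : (0 : ℝ) ≤ 2 * (s : ℝ) * Real.log N * |moebiusAPSum (t c) L (a c : ZMod L)| := by
      positivity
    refine ⟨t c, ht c hc, a c, ha c hc, ?_⟩
    calc ∑ c' ∈ 𝒞, |∑ b ∈ (Ioc N' N).filter (fun b : ℕ => b ≡ c' [MOD L]), (μ b : ℝ) * Real.log b|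
        ≤ ∑ c' ∈ 𝒞, 2 * (s : ℝ) * Real.log N * |moebiusAPSum (t c') L (a c' : ZMod L)| :=
          sum_le_sum fun c' hc' => hb c' hc'
      _ ≤ ∑ _c' ∈ 𝒞, 2 * (s : ℝ) * Real.log N * |moebiusAPSum (t c) L (a c : ZMod L)| :=
          sum_le_sum fun c' hc' => mul_le_mul_of_nonneg_left (hmax c' hc') (by positivity)
      _ = #𝒞 * (2 * (s : ℝ) * Real.log N * |moebiusAPSum (t c) L (a c : ZMod L)|) := by
          rw [sum_const, nsmul_eq_mul]
      _ ≤ (s : ℝ) * (2 * (s : ℝ) * Real.log N * |moebiusAPSum (t c) L (a c : ZMod L)|) :=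
          mul_le_mul_of_nonneg_right (by exact_mod_cast hcard) hK
      _ = 2 * (s : ℝ) ^ 2 * Real.log N * |moebiusAPSum (t c) L (a c : ZMod L)| := by ring
  · refine ⟨0, Nat.zero_le _, 1, Nat.coprime_one_left L, ?_⟩
    rw [Finset.not_nonempty_iff_eq_empty.1 h𝒞, sum_empty]
    positivity

end BVMoebius

end Literature.NumberTheory.Sieve
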